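import Mathlib
import Literature.Computability.AlgebraicComplexity.GroupTheoreticMatMulThmBProofs
import Literature.Computability.AlgebraicComplexity.PrattTrapezoidValSTPP
import Literature.Computability.AlgebraicComplexity.PrattTrapezoidValSliceRank
import Literature.Computability.AlgebraicComplexity.PrattTrapezoidValDecomp
import Literature.Barriers.MatrixMultiplication.TricoloredSumFreeBarrierEffective

/-!
# Tools for the large-block transfer toward `HomocyclicSTPPDesigns` (crux stmt-MatrixMultiplication-10647)

Support file of crux `EisensteinValCertificates.HomocyclicSTPPDesigns` (X′: for every `ε > 0` an STPP
family in some `(ℤ/q)^ℓ`, `q` a prime power, with `q^ℓ < Σ_i (|A_i||B_i||C_i|)^{(2+ε)/3}`).  The crux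
strategist (Cruxes/HomocyclicSTPPDesigns/STRATEGY-CENSUS.md §Transfer T1, SketchStrategist.lean §2–§3)
typed the LARGE-BLOCK TRANSFER `LargeBlockAbelianDesigns → X′` — STPP designs in ARBITRARY finite
abelian groups whose blocks have volume `≥ |H|^{α₀}` re-host into prime cyclic groups — with a proof
plan (Umans' cyclic reduction, Pratt 2024 arXiv:2309.03878 p. 10, run on STPP families instead of SDPP
pairs).  This file proves the four design-level tools the transfer composes; the transfer itself is
`EisensteinValCertificatesHomocyclicSTPPDesignsLargeBlockTransfer.lean`.

* `sum_rpow_two_thirds_le_of_addEquiv_piZMod` — **the slice-rank input for general STPP families**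
  (BCCGNSU 2017 Thm. 4.14 + §3.2): if `K ≃ (ℤ/q)^κ × G'` with `q = p^r` a prime power and `θ = θ_q`
  bounds the low-weight counts, then EVERY STPP family in `K` has `Σ_i (|A_i||B_i||C_i|)^{2/3} ≤
  θ^{|κ|} · |K|` — the tree's `sum_rpow_two_thirds_le_of_tsf` engine (word types + tensor powers) fed
  with the counting form of Thm. 4.14 (`IsTricoloredSumFree.card_le_of_addEquiv`) in the powers
  `((K^N)^3)^{N'} ≃ (ℤ/q)^{3NN'κ} × G'^{3NN'}`.  (The tree's `sum_card_div_le_of_addEquiv_piZMod` is the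
  `abc/(a+b+c)` form of the same input; the `2/3`-power form needs the word-type symmetrisation of §3.2.)
* `isSTPP_piPow`, `vol_piPow`, `sum_rpow_piPow`, `pow_le_vol_piPow` — tensor powers of a `Fin N`-indexed STPP family
  (`AddSimultaneousTPP.pi`, reindexed by `finFunctionFinEquiv`), block sizes multiply, and
  `Σ_w vol(w)^τ = (Σ_i vol(i)^τ)^m`.
* `sum_rpow_gain_of_blocks_ge` — raising the exponent from `(2+ε')/3` to `(2+ε)/3` gains the factor
  `M^{(ε-ε')/3}` on blocks of volume `≥ M` (strategist §3a).
* `exists_prime_isSTPP_of_addEquiv` — prime re-hosting (Pratt 2024 Thm 4.4/Cor 4.5/Thm 4.7 transfer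
  step at design level, strategist §2): an STPP family in `H ≃ ∏_{j<k} ℤ/m_j` has an image in `ℤ/p`,
  `p` prime, `p ≤ 2·3^k·∏ m_j`, again STPP with the same block sizes (mixed-radix Freiman map of the
  tree, `exists_freiman3_of_addEquiv`, + Bertrand).
-/

-- single-conjunct summit: the mandated namespace repeats `MatrixMultiplication` (summit = sub-problem).
set_option linter.dupNamespace false

namespace Summit.MatrixMultiplication.MatrixMultiplication.Theorems.HomocyclicSTPPDesigns.LargeBlock

open Finset Literature.Computability.AlgebraicComplexity Literature.Combinatorics.Additive
  Literature.Barriers.MatrixMultiplication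
open scoped BigOperators

/-! ## §1 The slice-rank bound for general STPP families in `K ≃ (ℤ/q)^κ × G'` -/

/-- **BCCGNSU 2017, Thm. 4.14 + §3.2 for a general STPP family**: if `K ≃ (ℤ/q)^κ × G'` with
`q = p^r` a prime power, `1 < |K|`, and `θ > 0` bounds the low-weight counts
(`#LowWeight q κ' ≤ (θq)^{|κ'|}` for all `κ'`, tree `exists_theta`), then every STPP family
`(A_i,B_i,C_i)_{i<N}` in `K` satisfies `Σ_i (|A_i||B_i||C_i|)^{2/3} ≤ θ^{|κ|} · |K|`.
Proof: the §3.2 engine `sum_rpow_two_thirds_le_of_tsf` with `|K|^{1-δ} := θ^{|κ|}|K|`, whose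
tricolored-sum-free hypothesis in `((K^N)^3)^{N'} ≃ (ℤ/q)^{N'·3·N·κ} × (G'^N)^{3·N'}` is the counting
form of Thm. 4.14 (`IsTricoloredSumFree.card_le_of_addEquiv`) and the low-weight estimate. -/
theorem sum_rpow_two_thirds_le_of_addEquiv_piZMod :
    ∀ {K : Type} [AddCommGroup K] [Fintype K] [DecidableEq K], 1 < Fintype.card K →
    ∀ {N : ℕ} {A B C : Fin N → Finset K}, IsSTPP A B C →
    ∀ {p : ℕ} [Fact p.Prime] {q : ℕ} [NeZero q] (r : ℕ), q = p ^ r →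
    ∀ {κ : Type} [Fintype κ] [DecidableEq κ] {G' : Type} [AddCommGroup G'] [Fintype G']
      [DecidableEq G'] (e : K ≃+ (κ → ZMod q) × G') {θ : ℝ}, 0 < θ →
    (∀ (κ' : Type) [Fintype κ'] [DecidableEq κ'],
      (Fintype.card (LowWeight q κ') : ℝ) ≤ (θ * q) ^ Fintype.card κ') →
    ∑ i, (((A i).card * (B i).card * (C i).card : ℕ) : ℝ) ^ ((2 : ℝ) / 3) ≤
      θ ^ Fintype.card κ * Fintype.card K := by
  intro K _ _ _ hK N A B C hS p _ q _ r hq κ _ _ G' _ _ _ e θ hθ0 hθ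
  have hS' := (isSTPP_iff_addSimultaneousTPP A B C).1 hS
  have hKpos : (0 : ℝ) < Fintype.card K := by exact_mod_cast Fintype.card_pos
  have hK1 : (1 : ℝ) < Fintype.card K := by exact_mod_cast hK
  have hlogK : Real.log (Fintype.card K) ≠ 0 := (Real.log_pos hK1).ne'
  -- `|K| = q^{|κ|} |G'|`
  have hcardK : (Fintype.card K : ℝ) = (q : ℝ) ^ Fintype.card κ * Fintype.card G' := by
    have h1 := Fintype.card_congr e.toEquiv
    rw [Fintype.card_prod, Fintype.card_fun, ZMod.card] at h1
    rw [h1]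
    push_cast
    rfl
  set Y : ℝ := θ ^ Fintype.card κ * Fintype.card K with hY
  have hYpos : 0 < Y := by positivity
  -- `|K|^{1-δ} = Y`
  set δ : ℝ := 1 - Real.log Y / Real.log (Fintype.card K) with hδ
  have hKδ : (Fintype.card K : ℝ) ^ (1 - δ) = Y := by
    have h1 : (1 : ℝ) - δ = Real.log Y / Real.log (Fintype.card K) := by rw [hδ]; ring
    rw [h1, Real.rpow_def_of_pos hKpos, mul_div_cancel₀ _ hlogK, Real.exp_log hYpos]
  -- the tricolored-sum-free hypothesis of the engine
  have hA : ∀ (N₁ N' : ℕ) (ι' : Type) [Fintype ι']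
      (s t u : ι' → (Fin N' → (Fin N₁ → K) × (Fin N₁ → K) × (Fin N₁ → K))),
      IsTricoloredSumFree s t u →
        (Fintype.card ι' : ℝ) ≤ 3 * (((Fintype.card K : ℝ) ^ (1 - δ)) ^ (3 * N₁)) ^ N' := by
    intro N₁ N' ι' _ s t u hT
    obtain ⟨e₁⟩ := nonempty_addEquiv_pi_of_addEquiv e N₁
    obtain ⟨e₂⟩ := nonempty_addEquiv_triple e₁
    obtain ⟨e₃⟩ := nonempty_addEquiv_pi_of_addEquiv e₂ N'
    have hb := hT.card_le_of_addEquiv (p := p) r hq e₃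
    have hLW := hθ (Fin N' × ((Fin N₁ × κ) ⊕ ((Fin N₁ × κ) ⊕ (Fin N₁ × κ))))
    have hcardκ : Fintype.card (Fin N' × ((Fin N₁ × κ) ⊕ ((Fin N₁ × κ) ⊕ (Fin N₁ × κ)))) =
        N' * (3 * (N₁ * Fintype.card κ)) := by
      simp only [Fintype.card_prod, Fintype.card_sum, Fintype.card_fin]
      ring
    have hcardG : (Fintype.card (Fin N' → (Fin N₁ → G') × ((Fin N₁ → G') × (Fin N₁ → G'))) : ℝ) =
        (((Fintype.card G' : ℝ) ^ N₁) ^ 3) ^ N' := by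
      rw [Fintype.card_fun, Fintype.card_prod, Fintype.card_prod, Fintype.card_fun,
        Fintype.card_fin, Fintype.card_fin]
      push_cast
      ring
    have hLW' : (Fintype.card (LowWeight q (Fin N' × ((Fin N₁ × κ) ⊕ ((Fin N₁ × κ) ⊕ (Fin N₁ × κ))))) : ℝ)
        ≤ (θ * q) ^ (N' * (3 * (N₁ * Fintype.card κ))) := by
      calc _ ≤ _ := hLW
        _ = (θ * q) ^ (N' * (3 * (N₁ * Fintype.card κ))) := by rw [hcardκ]
    calc (Fintype.card ι' : ℝ)
        ≤ ((3 * Fintype.card (LowWeight q (Fin N' × ((Fin N₁ × κ) ⊕ ((Fin N₁ × κ) ⊕ (Fin N₁ × κ)))))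
            * Fintype.card (Fin N' → (Fin N₁ → G') × ((Fin N₁ → G') × (Fin N₁ → G'))) : ℕ) : ℝ) := by
          exact_mod_cast hb
      _ = 3 * (Fintype.card (LowWeight q (Fin N' × ((Fin N₁ × κ) ⊕ ((Fin N₁ × κ) ⊕ (Fin N₁ × κ))))) : ℝ)
            * (((Fintype.card G' : ℝ) ^ N₁) ^ 3) ^ N' := by
          rw [← hcardG]; push_cast; ring
      _ ≤ 3 * (θ * q) ^ (N' * (3 * (N₁ * Fintype.card κ))) * (((Fintype.card G' : ℝ) ^ N₁) ^ 3) ^ N' := by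
          gcongr
      _ = 3 * (((Fintype.card K : ℝ) ^ (1 - δ)) ^ (3 * N₁)) ^ N' := by
          rw [hKδ, hY, hcardK]
          ring
  have h := sum_rpow_two_thirds_le_of_tsf hA hS'
  rwa [hKδ] at h

/-! ## §2 Tensor powers of a `Fin N`-indexed STPP family

The `m`-th tensor power of a `Fin N`-indexed family `A` of finsets of `K` is the family of blocks
`∏_{l<m} A (w_l) ⊆ K^m = (Fin m → K)` indexed by `w ∈ Fin (N^m) ≃ (Fin m → Fin N)`, written inline as
`fun w => Fintype.piFinset fun l => A (finFunctionFinEquiv.symm w l)`. -/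

section PiPow

variable {K : Type*} {N : ℕ}

/-- Tensor powers of an STPP family are STPP families (CKSU 2005 Lemma 5.4 / BCCGNSU 2017 proof of
Lemma 3.5; tree `AddSimultaneousTPP.pi`, reindexed along `finFunctionFinEquiv`). -/
theorem isSTPP_piPow [AddCommGroup K] {A B C : Fin N → Finset K} (hS : IsSTPP A B C) (m : ℕ) :
    IsSTPP (fun w : Fin (N ^ m) => Fintype.piFinset fun l : Fin m => A (finFunctionFinEquiv.symm w l))
      (fun w : Fin (N ^ m) => Fintype.piFinset fun l : Fin m => B (finFunctionFinEquiv.symm w l))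
      (fun w : Fin (N ^ m) => Fintype.piFinset fun l : Fin m => C (finFunctionFinEquiv.symm w l)) := by
  classical
  have h := ((isSTPP_iff_addSimultaneousTPP A B C).1 hS).pi (κ := Fin m)
  have h' := h.comp (e := fun w : Fin (N ^ m) => finFunctionFinEquiv.symm w)
    finFunctionFinEquiv.symm.injective
  exact (isSTPP_iff_addSimultaneousTPP _ _ _).2 h'

/-- Volumes multiply: `|A_w||B_w||C_w| = ∏_l |A_{w_l}||B_{w_l}||C_{w_l}|` for the tensor power
(`Fintype.card_piFinset`). -/
theorem vol_piPow (A B C : Fin N → Finset K) (m : ℕ) (w : Fin (N ^ m)) :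
    (Fintype.piFinset fun l : Fin m => A (finFunctionFinEquiv.symm w l)).card *
        (Fintype.piFinset fun l : Fin m => B (finFunctionFinEquiv.symm w l)).card *
        (Fintype.piFinset fun l : Fin m => C (finFunctionFinEquiv.symm w l)).card =
      ∏ l : Fin m, ((A (finFunctionFinEquiv.symm w l)).card *
        (B (finFunctionFinEquiv.symm w l)).card * (C (finFunctionFinEquiv.symm w l)).card) := by
  rw [Fintype.card_piFinset, Fintype.card_piFinset, Fintype.card_piFinset, Finset.prod_mul_distrib,
    Finset.prod_mul_distrib]

/-- The packing sum of the tensor power is the power of the packing sum: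
`Σ_w (|A_w||B_w||C_w|)^τ = (Σ_i (|A_i||B_i||C_i|)^τ)^m` (`Fintype.prod_sum`). -/
theorem sum_rpow_piPow (A B C : Fin N → Finset K) (m : ℕ) (τ : ℝ) :
    ∑ w : Fin (N ^ m), (((Fintype.piFinset fun l : Fin m => A (finFunctionFinEquiv.symm w l)).card *
        (Fintype.piFinset fun l : Fin m => B (finFunctionFinEquiv.symm w l)).card *
        (Fintype.piFinset fun l : Fin m => C (finFunctionFinEquiv.symm w l)).card : ℕ) : ℝ) ^ τ =
      (∑ i : Fin N, (((A i).card * (B i).card * (C i).card : ℕ) : ℝ) ^ τ) ^ m := by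
  set v : Fin N → ℕ := fun i => (A i).card * (B i).card * (C i).card with hv
  have h1 : ∀ w : Fin (N ^ m),
      (((Fintype.piFinset fun l : Fin m => A (finFunctionFinEquiv.symm w l)).card *
        (Fintype.piFinset fun l : Fin m => B (finFunctionFinEquiv.symm w l)).card *
        (Fintype.piFinset fun l : Fin m => C (finFunctionFinEquiv.symm w l)).card : ℕ) : ℝ) ^ τ =
        ∏ l : Fin m, ((v (finFunctionFinEquiv.symm w l) : ℕ) : ℝ) ^ τ := by
    intro w
    rw [vol_piPow, Nat.cast_prod, Real.finsetProd_rpow _ _ (fun l _ => by positivity)]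
  rw [Finset.sum_congr rfl fun w _ => h1 w]
  rw [show (∑ w : Fin (N ^ m), ∏ l : Fin m, ((v (finFunctionFinEquiv.symm w l) : ℕ) : ℝ) ^ τ) =
      ∑ I : Fin m → Fin N, ∏ l : Fin m, ((v (I l) : ℕ) : ℝ) ^ τ from
    finFunctionFinEquiv.symm.sum_comp (fun I : Fin m → Fin N => ∏ l : Fin m, ((v (I l) : ℕ) : ℝ) ^ τ)]
  rw [← Fintype.prod_sum (fun (_ : Fin m) (i : Fin N) => ((v i : ℕ) : ℝ) ^ τ), Finset.prod_const,
    Finset.card_univ, Fintype.card_fin]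

/-- Large blocks stay large: if every block has volume `≥ M ≥ 0` then every block of the `m`-th
tensor power has volume `≥ M^m`. -/
theorem pow_le_vol_piPow (A B C : Fin N → Finset K) (m : ℕ) {M : ℝ} (hM : 0 ≤ M)
    (hvol : ∀ i, M ≤ (((A i).card * (B i).card * (C i).card : ℕ) : ℝ)) (w : Fin (N ^ m)) :
    M ^ m ≤ (((Fintype.piFinset fun l : Fin m => A (finFunctionFinEquiv.symm w l)).card *
        (Fintype.piFinset fun l : Fin m => B (finFunctionFinEquiv.symm w l)).card *
        (Fintype.piFinset fun l : Fin m => C (finFunctionFinEquiv.symm w l)).card : ℕ) : ℝ) := by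
  rw [vol_piPow, Nat.cast_prod]
  calc M ^ m = ∏ _l : Fin m, M := by rw [Finset.prod_const, Finset.card_univ, Fintype.card_fin]
    _ ≤ ∏ l : Fin m, (((A (finFunctionFinEquiv.symm w l)).card *
          (B (finFunctionFinEquiv.symm w l)).card * (C (finFunctionFinEquiv.symm w l)).card : ℕ) : ℝ) :=
        Finset.prod_le_prod (fun l _ => hM) fun l _ => hvol _

end PiPow

/-! ## §3 The exponent gain on large blocks -/

/-- Raising the exponent from `(2+ε')/3` to `(2+ε)/3` multiplies a sum over blocks of volume `≥ M ≥ 1`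
by at least `M^{(ε-ε')/3}` (crux strategist, SketchStrategist.lean §3a). -/
theorem sum_rpow_gain_of_blocks_ge {ι : Type*} (S : Finset ι) (x : ι → ℕ) {M ε ε' : ℝ}
    (hM : 1 ≤ M) (hle : ε' ≤ ε) (hx : ∀ i ∈ S, M ≤ (x i : ℝ)) :
    M ^ ((ε - ε') / 3) * ∑ i ∈ S, ((x i : ℕ) : ℝ) ^ ((2 + ε') / 3) ≤
      ∑ i ∈ S, ((x i : ℕ) : ℝ) ^ ((2 + ε) / 3) := by
  rw [Finset.mul_sum]
  refine Finset.sum_le_sum fun i hi => ?_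
  have hxi : M ≤ (x i : ℝ) := hx i hi
  have hx1 : (1 : ℝ) ≤ (x i : ℝ) := le_trans hM hxi
  have hx0 : (0 : ℝ) < (x i : ℝ) := lt_of_lt_of_le one_pos hx1
  have hsplit : ((x i : ℕ) : ℝ) ^ ((2 + ε) / 3) =
      ((x i : ℕ) : ℝ) ^ ((ε - ε') / 3) * ((x i : ℕ) : ℝ) ^ ((2 + ε') / 3) := by
    rw [← Real.rpow_add hx0]; congr 1; ring
  rw [hsplit]
  refine mul_le_mul_of_nonneg_right ?_ (Real.rpow_nonneg hx0.le _)
  exact Real.rpow_le_rpow (le_trans zero_le_one hM) hxi (by linarith)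

/-! ## §4 Prime re-hosting of an STPP family -/

/-- **Prime re-hosting of STPP families** (the transfer step of Pratt 2024 Thm 4.4 / Cor 4.5 /
Thm 4.7, arXiv:2309.03878 pp. 9–10, as a design-level lemma; crux strategist, SketchStrategist.lean
§2): an STPP family in `H ≃+ ∏_{j<k} ℤ/m_j` (`m_j > 0`) has an image in `ℤ/p` for some prime
`p ≤ 2 · 3^k · ∏ m_j` which is again STPP with the same block sizes — the tree's mixed-radix Freiman
map `exists_freiman3_of_addEquiv` reflects `a+b+c = a'+b'+c'`, so it is injective and carries
`AddSimultaneousTPP` families to `AddSimultaneousTPP` families (`addSimultaneousTPP_image_of_reflect`);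
Bertrand supplies the prime. -/
theorem exists_prime_isSTPP_of_addEquiv {H : Type*} [AddCommGroup H] {N : ℕ}
    {A B C : Fin N → Finset H} (hS : IsSTPP A B C)
    {k : ℕ} {m : Fin k → ℕ} (hm : ∀ j, 0 < m j) (e : H ≃+ Π j, ZMod (m j)) :
    ∃ p : ℕ, p.Prime ∧ p ≤ 2 * (3 ^ k * ∏ j, m j) ∧
      ∃ A' B' C' : Fin N → Finset (ZMod p), IsSTPP A' B' C' ∧
        ∀ i, (A' i).card = (A i).card ∧ (B' i).card = (B i).card ∧ (C' i).card = (C i).card := by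
  classical
  obtain ⟨ψ, h1, h2⟩ := exists_freiman3_of_addEquiv hm e
  set R : ℕ := 3 ^ k * ∏ j, m j with hR
  have hR0 : R ≠ 0 := by have := h1 0 0 0; omega
  obtain ⟨p, hp, hRp, hp2R⟩ := Nat.exists_prime_lt_and_le_two_mul R hR0
  haveI : Fact p.Prime := ⟨hp⟩
  set φ : H → ZMod p := fun x => ((ψ x : ℕ) : ZMod p) with hφ
  have h3sum : ∀ a b c, ψ a + ψ b + ψ c < p := fun a b c => lt_trans (h1 a b c) hRp
  have hφr : ∀ a b c a' b' c', φ a + φ b + φ c = φ a' + φ b' + φ c' →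
      a + b + c = a' + b' + c' := by
    intro a b c a' b' c' h
    have h' : ((ψ a + ψ b + ψ c : ℕ) : ZMod p) = ((ψ a' + ψ b' + ψ c' : ℕ) : ZMod p) := by
      push_cast; exact h
    rw [ZMod.natCast_eq_natCast_iff', Nat.mod_eq_of_lt (h3sum _ _ _),
      Nat.mod_eq_of_lt (h3sum _ _ _)] at h'
    exact h2 a b c a' b' c' h'
  have hinj := injective_of_reflect φ hφr
  have himg := addSimultaneousTPP_image_of_reflect ((isSTPP_iff_addSimultaneousTPP A B C).1 hS) φ hφr
  exact ⟨p, hp, hp2R, fun i => (A i).image φ, fun i => (B i).image φ, fun i => (C i).image φ,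
    (isSTPP_iff_addSimultaneousTPP _ _ _).2 himg, fun i =>
      ⟨card_image_of_injective _ hinj, card_image_of_injective _ hinj,
        card_image_of_injective _ hinj⟩⟩

end Summit.MatrixMultiplication.MatrixMultiplication.Theorems.HomocyclicSTPPDesigns.LargeBlock
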